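import Literature.AlgebraicGeometry.HodgeTheory.ComplementLocalTrivialityRationalOpen
import HarnessLib

/-!
# Generic local triviality of the complement over a `k`-rational open — total space not irreducible

Topic `Literature/AlgebraicGeometry/HodgeTheory` (family `hodge`). Theorems only (no definition, no
named fact; D-0026). Sequel of `ComplementLocalTrivialityRationalOpen.lean`
(`exists_opens_isLocallyTrivialFibration_compl_of_baseChangeHom`: for `σ : k →+* ℂ`, `k` of
characteristic zero, `g₀ : X₀ ⟶ B₀` proper and smooth with `X₀` INTEGRAL, `B₀` an integral
separated smooth `k`-scheme of finite type, and `C₀ ⊆ X₀` closed, there is a `k`-rational open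
`O₀ ∋ η_{B₀}` over which the complement of `C₀` in the complexified family is a locally trivial
fibration). Here the integrality hypothesis on the total space `X₀` is REMOVED, exactly as Part 2
of `AlgebraicityLocusIUnionClosedProofs` does over `ℂ` (`exists_opens_isLocallyTrivialFibration_compl`
from `exists_opens_isLocallyTrivialFibration_compl_of_isIrreducible`): `X₀` is smooth over `k`,
hence regular, so its finitely many irreducible components are open, closed and pairwise disjoint
(`Resolution.Scheme.IsRegular.coe_irreducibleComponentOpen`); the integral case is applied to each
component not inside `C₀` (an integral open-and-closed subscheme, proper and smooth over `B₀`),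
transported to the complex points of `X = X₀ ⊗_σ ℂ` lying over that component (the
complexification of an open immersion is an open immersion, and `AlgPoints.map` of an open
immersion is an open embedding of complex points), the `k`-rational opens are intersected, and
the fibrations are glued over the finite clopen partition of the total space by components
(`IsLocallyTrivialFibration.of_isLocallyConstant`); components inside `C₀` contribute empty pieces.
The smoothness hypothesis on `g₀` is plain `Smooth` (each integral piece is smooth of SOME
relative dimension, `Motives.exists_smoothOfRelativeDimension_of_smooth`), which is what the
spreading argument for the variational Hodge conjecture supplies (the relative dimension of a
family descended to `k` is read on its complexification only).

* `isRegular_left_of_smooth` — `X₀` is regular when `g₀` is smooth and `B₀` is smooth over `k`.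
* `exists_opens_isLocallyTrivialFibration_compl_of_baseChangeHom_piece` — the statement for the
  complex points over ONE irreducible component `W ⊆ X₀`.
* `exists_opens_isLocallyTrivialFibration_compl_of_baseChangeHom'` — the statement of
  `exists_opens_isLocallyTrivialFibration_compl_of_baseChangeHom` without `IsIntegral X₀.left`
  and with `Smooth g₀.left` in place of `SmoothOfRelativeDimension n g₀.left`.

## References

* [VoisinHodgeI2002] C. Voisin, Hodge Theory and Complex Algebraic Geometry I (2002), §9.1.1,
  Thm. 9.3, Prop. 9.5.
* [CharlesSchnell2014Notes] F. Charles, C. Schnell, Notes on absolute Hodge classes (2014),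
  Prop. 11.3.11 (proof), Lemma 11.3.14.
* [Kollar2007] J. Kollár, Lectures on Resolution of Singularities (2007), Thm. 3.35.
-/

noncomputable section

open CategoryTheory AlgebraicGeometry Limits Set TopologicalSpace
open _root_.Topology
open Literature.AlgebraicGeometry.Motives Literature.AlgebraicGeometry.Resolution
open Literature.AlgebraicTopology.Homotopy

namespace Literature.AlgebraicGeometry.HodgeTheory

section Pieces

variable {k : Type} [Field k] [CharZero k] (σ : k →+* ℂ) {X₀ B₀ : SchemeOver k} (g₀ : X₀ ⟶ B₀)
  {d : ℕ}

omit [CharZero k] in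
/-- **The total space of a smooth family over a smooth base is regular**: for `g₀ : X₀ ⟶ B₀`
smooth and `B₀` smooth over the field `k`, every local ring of `X₀` is regular (`X₀ → Spec k` is
smooth, hence locally smooth of some relative dimension, Görtz–Wedhorn I, Lemma 6.26).
[cite: GortzWedhorn2020, Lemma 6.26] -/
theorem isRegular_left_of_smooth [Smooth g₀.left] [SmoothOfRelativeDimension d B₀.hom] :
    Scheme.IsRegular X₀.left := by
  haveI : Smooth B₀.hom := SmoothOfRelativeDimension.smooth d B₀.hom
  haveI : Smooth X₀.hom := by rw [← Over.w g₀]; infer_instance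
  intro x
  obtain ⟨V, n, hxV, hV⟩ := exists_opens_smoothOfRelativeDimension_of_smooth X₀.hom x
  haveI := hV
  haveI : IsRegularLocalRing ((V : Scheme).presheaf.stalk ⟨x, hxV⟩) :=
    isRegularLocalRing_stalk_of_smoothOfRelativeDimension (V.ι ≫ X₀.hom) n ⟨x, hxV⟩
  exact IsRegularLocalRing.of_ringEquiv (asIso (V.ι.stalkMap ⟨x, hxV⟩)).commRingCatIsoToRingEquiv.symm

/-- **Generic local triviality of the complement over a `k`-rational open, for the complex points
over one irreducible component.** Let `σ : k →+* ℂ` (`k` of characteristic zero), `g₀ : X₀ ⟶ B₀`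
proper and smooth, `B₀` integral, separated, quasi-compact, locally of finite type and smooth of
relative dimension `d` over `k`; let `W ⊆ X₀` be open, closed and irreducible, and `C₀ ⊆ X₀`
closed. Then there is an open `O₀ ∋ η_{B₀}` of `B₀` such that
`{x ∈ X(ℂ) | π_X x ∈ W, π_X x ∉ C₀, π_B (g x) ∈ O₀} → {β ∈ B(ℂ) | π_B β ∈ O₀}` is a locally trivial
fibration (`X = X₀ ⊗_σ ℂ`, `B = B₀ ⊗_σ ℂ`). Proof: `W` with its open-subscheme structure is an
integral `k`-scheme, proper (a clopen immersion is a closed immersion) and smooth of some relative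
dimension over `B₀`; apply `exists_opens_isLocallyTrivialFibration_compl_of_baseChangeHom` to it
and transport along the open embedding `W_σ(ℂ) ↪ X(ℂ)`, whose range is `{x | π_X x ∈ W}`.
[cite: VoisinHodgeI2002, §9.1.1, Thm. 9.3] [cite: CharlesSchnell2014Notes, Prop. 11.3.11 (proof) and Lemma 11.3.14] -/
theorem exists_opens_isLocallyTrivialFibration_compl_of_baseChangeHom_piece
    [IsProper g₀.left] [Smooth g₀.left] [IsIntegral B₀.left] [LocallyOfFiniteType B₀.hom]
    [SmoothOfRelativeDimension d B₀.hom] [IsSeparated B₀.hom] [CompactSpace B₀.left]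
    (W : X₀.left.Opens) (hWc : IsClosed (W : Set X₀.left)) (hWirr : IsIrreducible (W : Set X₀.left))
    (C₀ : Set X₀.left) (hC₀ : IsClosed C₀) :
    ∃ O₀ : B₀.left.Opens, genericPoint B₀.left ∈ O₀ ∧
      IsLocallyTrivialFibration
        (fun x : {x : ComplexPoints ((baseChangeHom σ).obj X₀) //
            baseChangeHomFst σ X₀ x.pt ∈ W ∧ baseChangeHomFst σ X₀ x.pt ∉ C₀ ∧
              baseChangeHomFst σ B₀ (((baseChangeHom σ).map g₀).left x.pt) ∈ O₀} =>
          (⟨AlgPoints.map ((baseChangeHom σ).map g₀) x.1, x.2.2.2⟩ :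
            {β : ComplexPoints ((baseChangeHom σ).obj B₀) // baseChangeHomFst σ B₀ β.pt ∈ O₀})) := by
  classical
  letI := σ.toAlgebra
  -- ### the piece `W` as an integral `k`-scheme, proper and smooth over `B₀`
  haveI : Smooth B₀.hom := SmoothOfRelativeDimension.smooth d B₀.hom
  haveI : Smooth X₀.hom := by rw [← Over.w g₀]; infer_instance
  haveI : IsReduced X₀.left := isReduced_of_smooth_over_field X₀.hom
  let X₀c : SchemeOver k := Over.mk (W.ι ≫ X₀.hom)
  let jc : X₀c ⟶ X₀ := Over.homMk W.ι rfl
  let g₀c : X₀c ⟶ B₀ := jc ≫ g₀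
  haveI hWci : IsClosedImmersion W.ι :=
    IsClosedImmersion.of_isPreimmersion _ (by rw [Scheme.Opens.range_ι]; exact hWc)
  haveI : IsClosedImmersion jc.left := hWci
  haveI : IsOpenImmersion jc.left := inferInstanceAs (IsOpenImmersion W.ι)
  haveI : IsProper g₀c.left := by
    change IsProper (W.ι ≫ g₀.left)
    infer_instance
  haveI : Smooth g₀c.left := by
    change Smooth (W.ι ≫ g₀.left)
    infer_instance
  haveI hWirrS : IrreducibleSpace (W : Scheme) := Subtype.irreducibleSpace hWirr
  haveI hWred : IsReduced (W : Scheme) :=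
    @isReduced_of_isOpenImmersion (W : Scheme) X₀.left W.ι inferInstance inferInstance
  haveI hWint : IsIntegral (W : Scheme) := isIntegral_of_irreducibleSpace_of_isReduced _
  haveI : IrreducibleSpace X₀c.left := hWirrS
  haveI : IsIntegral X₀c.left := hWint
  obtain ⟨nc, hnc⟩ := exists_smoothOfRelativeDimension_of_smooth (f := g₀c.left)
  haveI := hnc
  -- the closed subset `C₀c = C₀ ∩ W` of `W`
  let C₀c : Set X₀c.left := (W.ι : X₀c.left → X₀.left) ⁻¹' C₀
  have hC₀c : IsClosed C₀c := hC₀.preimage W.ι.continuous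
  -- ### the integral case, for the piece
  obtain ⟨O₀, hη, hF⟩ :=
    exists_opens_isLocallyTrivialFibration_compl_of_baseChangeHom σ g₀c (n := nc) (d := d) C₀c hC₀c
  refine ⟨O₀, hη, ?_⟩
  -- ### notation for the complexified data
  let X : SchemeOver ℂ := (baseChangeHom σ).obj X₀
  let B : SchemeOver ℂ := (baseChangeHom σ).obj B₀
  let Xc : SchemeOver ℂ := (baseChangeHom σ).obj X₀c
  let g : X ⟶ B := (baseChangeHom σ).map g₀
  let gc : Xc ⟶ B := (baseChangeHom σ).map g₀c
  let jC : Xc ⟶ X := (baseChangeHom σ).map jc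
  let prX : X.left ⟶ X₀.left := baseChangeHomFst σ X₀
  let prB : B.left ⟶ B₀.left := baseChangeHomFst σ B₀
  let prXc : Xc.left ⟶ X₀c.left := baseChangeHomFst σ X₀c
  have hgc : gc = jC ≫ g := (baseChangeHom σ).map_comp jc g₀
  -- the complexified open immersion `jC : W_σ ⟶ X` and its range
  have Hj : IsPullback jC.left prXc prX jc.left := isPullback_baseChange_map_left ℂ jc
  haveI : IsOpenImmersion jC.left :=
    MorphismProperty.of_isPullback (P := @IsOpenImmersion) Hj.flip inferInstance
  have hjw : ∀ z : Xc.left, prX (jC.left z) = W.ι (prXc z) := fun z => by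
    have h : (jC.left ≫ prX) z = (prXc ≫ jc.left) z := by rw [Hj.w]
    rwa [Scheme.Hom.comp_apply, Scheme.Hom.comp_apply] at h
  have hgc' : ∀ P : ComplexPoints Xc, AlgPoints.map gc P = AlgPoints.map g (AlgPoints.map jC P) :=
    fun P => by rw [hgc, AlgPoints.map_comp_apply]
  have hrange : Set.range jC.left = prX ⁻¹' (W : Set X₀.left) := by
    ext x
    constructor
    · rintro ⟨z, rfl⟩
      change prX (jC.left z) ∈ (W : Set X₀.left)
      rw [hjw]
      exact (prXc z).2
    · intro hx
      obtain ⟨z, hz, -⟩ := Scheme.Pullback.exists_preimage_pullback (f := prX) (g := jc.left) x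
        ⟨prX x, hx⟩ rfl
      refine ⟨Hj.isoPullback.inv z, ?_⟩
      rw [← Scheme.Hom.comp_apply, IsPullback.isoPullback_inv_fst]
      exact hz
  -- ### the embedding of the source of `hF` into `X(ℂ)` and its range
  let Src := {x' : ComplexPoints Xc // prXc x'.pt ∉ C₀c ∧ prB (gc.left x'.pt) ∈ O₀}
  let Tgt : Set (ComplexPoints X) :=
    {x | prX x.pt ∈ W ∧ prX x.pt ∉ C₀ ∧ prB (g.left x.pt) ∈ O₀}
  let F : Src → ComplexPoints X := fun x' => AlgPoints.map jC x'.1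
  have hFe : IsEmbedding F :=
    (AlgPoints.isOpenEmbedding_map_holds jC).isEmbedding.comp IsEmbedding.subtypeVal
  have hgpt : ∀ z : ComplexPoints Xc, g.left (AlgPoints.map jC z).pt = gc.left z.pt := fun z => by
    rw [hgc, AlgPoints.pt_map]; rfl
  have hFrange : Set.range F = Tgt := by
    ext x
    constructor
    · rintro ⟨x', rfl⟩
      refine ⟨?_, ?_, ?_⟩
      · change prX (jC.left x'.1.pt) ∈ W
        rw [hjw]; exact (prXc x'.1.pt).2
      · change prX (jC.left x'.1.pt) ∉ C₀
        rw [hjw]; exact x'.2.1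
      · change prB (g.left (AlgPoints.map jC x'.1).pt) ∈ O₀
        rw [hgpt]; exact x'.2.2
    · rintro ⟨hxW, hxC, hxO⟩
      have hx : x.pt ∈ jC.left.opensRange := by
        change x.pt ∈ Set.range jC.left
        rw [hrange]; exact hxW
      obtain ⟨z, hz⟩ : x ∈ Set.range (AlgPoints.map jC : ComplexPoints Xc → ComplexPoints X) := by
        rw [AlgPoints.range_map_of_isOpenImmersion_holds jC]; exact hx
      refine ⟨⟨z, ?_, ?_⟩, hz⟩
      · change W.ι (prXc z.pt) ∉ C₀
        rw [← hjw]
        change prX (AlgPoints.map jC z).pt ∉ C₀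
        rw [hz]; exact hxC
      · rw [← hgpt, hz]; exact hxO
  obtain ⟨α, hα⟩ := exists_homeomorph_of_range_eq (i := (Subtype.val : ↥Tgt → ComplexPoints X))
    IsEmbedding.subtypeVal hFe (by rw [hFrange]; exact Subtype.range_coe)
  -- ### transport
  refine IsLocallyTrivialFibration.of_homeomorph hF α (Homeomorph.refl _) fun x => ?_
  apply Subtype.ext
  change AlgPoints.map gc (α x).1 = AlgPoints.map g x.1
  rw [hgc']
  exact congrArg (AlgPoints.map g) (hα x)

/-- **Generic local triviality of the complement of a closed subset, over a `k`-rational open —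
without integrality of the total space.** Let `σ : k →+* ℂ` with `k` of characteristic zero,
`g₀ : X₀ ⟶ B₀` a proper smooth morphism of `k`-schemes, `B₀` integral, separated, quasi-compact,
locally of finite type and smooth of relative dimension `d` over `k`, and `C₀ ⊆ X₀` closed. Then
there is an open `O₀ ⊆ B₀` containing the generic point of `B₀` such that, for the complexified
family `g = g₀ ⊗_σ ℂ : X ⟶ B`, the map
`{x ∈ X(ℂ) | π_X x ∉ C₀, π_B (g x) ∈ O₀} → {β ∈ B(ℂ) | π_B β ∈ O₀}` is a locally trivial fibration.
(`X₀` is Noetherian and regular, so its finitely many irreducible components are open, closed and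
pairwise disjoint; intersect the opens of
`exists_opens_isLocallyTrivialFibration_compl_of_baseChangeHom_piece` for the components not
inside `C₀` and glue over the finite clopen partition of the total space by the component of
`π_X x` (`IsLocallyTrivialFibration.of_isLocallyConstant`); components inside `C₀` contribute
empty pieces.) [cite: VoisinHodgeI2002, §9.1.1, Thm. 9.3, Prop. 9.5]
[cite: CharlesSchnell2014Notes, Prop. 11.3.11 (proof) and Lemma 11.3.14] -/
theorem exists_opens_isLocallyTrivialFibration_compl_of_baseChangeHom'
    [IsProper g₀.left] [Smooth g₀.left] [IsIntegral B₀.left] [LocallyOfFiniteType B₀.hom]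
    [SmoothOfRelativeDimension d B₀.hom] [IsSeparated B₀.hom] [CompactSpace B₀.left]
    (C₀ : Set X₀.left) (hC₀ : IsClosed C₀) :
    ∃ O₀ : B₀.left.Opens, genericPoint B₀.left ∈ O₀ ∧
      IsLocallyTrivialFibration
        (fun x : {x : ComplexPoints ((baseChangeHom σ).obj X₀) //
            baseChangeHomFst σ X₀ x.pt ∉ C₀ ∧
              baseChangeHomFst σ B₀ (((baseChangeHom σ).map g₀).left x.pt) ∈ O₀} =>
          (⟨AlgPoints.map ((baseChangeHom σ).map g₀) x.1, x.2.2⟩ :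
            {β : ComplexPoints ((baseChangeHom σ).obj B₀) // baseChangeHomFst σ B₀ β.pt ∈ O₀})) := by
  classical
  -- ### `X₀` is Noetherian and regular: components are clopen and disjoint
  haveI : LocallyOfFiniteType X₀.hom := by rw [← Over.w g₀]; infer_instance
  haveI : CompactSpace X₀.left := QuasiCompact.compactSpace_of_compactSpace g₀.left
  haveI : IsLocallyNoetherian X₀.left := LocallyOfFiniteType.isLocallyNoetherian X₀.hom
  haveI : IsNoetherian X₀.left := {}
  have hXreg : Scheme.IsRegular X₀.left := isRegular_left_of_smooth g₀ (d := d)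
  let S : Set (Set X₀.left) := irreducibleComponents X₀.left
  have hSfin : S.Finite := NoetherianSpace.finite_irreducibleComponents
  haveI : Finite ↥S := hSfin.to_subtype
  let Wc : ↥S → X₀.left.Opens := fun c => X₀.left.irreducibleComponentOpen c.1
  have hWc : ∀ c : ↥S, (Wc c : Set X₀.left) = c.1 := fun c => hXreg.coe_irreducibleComponentOpen c.2
  have hWcl : ∀ c : ↥S, IsClosed (Wc c : Set X₀.left) := fun c => by
    rw [hWc]; exact isClosed_of_mem_irreducibleComponents _ c.2
  have hWirr : ∀ c : ↥S, IsIrreducible (Wc c : Set X₀.left) := fun c => by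
    rw [hWc]; exact c.2.1
  -- ### notation for the complexified data
  let X : SchemeOver ℂ := (baseChangeHom σ).obj X₀
  let B : SchemeOver ℂ := (baseChangeHom σ).obj B₀
  let g : X ⟶ B := (baseChangeHom σ).map g₀
  let prX : X.left ⟶ X₀.left := baseChangeHomFst σ X₀
  let prB : B.left ⟶ B₀.left := baseChangeHomFst σ B₀
  -- the component of (the image in `X₀` of) a complex point
  let part : ComplexPoints X → ↥S := fun x =>
    ⟨irreducibleComponent (prX x.pt), irreducibleComponent_mem_irreducibleComponents _⟩
  have hmem_part : ∀ x, prX x.pt ∈ Wc (part x) := fun x => by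
    rw [← SetLike.mem_coe, hWc]
    exact mem_irreducibleComponent
  have hpart_eq : ∀ x c, prX x.pt ∈ Wc c → part x = c := fun x c hx => by
    rw [← SetLike.mem_coe, hWc] at hx
    exact Subtype.ext (hXreg.eq_of_mem_irreducibleComponents (prX x.pt)
      (irreducibleComponent_mem_irreducibleComponents _) c.2 mem_irreducibleComponent hx)
  have hpart : IsLocallyConstant part := by
    rw [IsLocallyConstant.iff_isOpen_fiber]
    intro c
    have h : part ⁻¹' {c} = {x | x.pt ∈ prX ⁻¹ᵁ (Wc c)} := by
      ext x
      simp only [Set.mem_preimage, Set.mem_singleton_iff, Set.mem_setOf_eq]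
      exact ⟨fun h => h ▸ hmem_part x, hpart_eq x c⟩
    rw [h]
    exact AlgPoints.isOpen_setOf_pt_mem (prX ⁻¹ᵁ (Wc c))
  -- ### the opens of the pieces
  have hpiece : ∀ c : ↥S, ∃ Oc : B₀.left.Opens, genericPoint B₀.left ∈ Oc ∧
      (c.1 ⊆ C₀ ∨ IsLocallyTrivialFibration
        (fun x : {x : ComplexPoints X // prX x.pt ∈ Wc c ∧ prX x.pt ∉ C₀ ∧ prB (g.left x.pt) ∈ Oc} =>
          (⟨AlgPoints.map g x.1, x.2.2.2⟩ : {β : ComplexPoints B // prB β.pt ∈ Oc}))) := by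
    intro c
    by_cases hcC : c.1 ⊆ C₀
    · exact ⟨⊤, trivial, Or.inl hcC⟩
    · obtain ⟨Oc, hη, hT⟩ := exists_opens_isLocallyTrivialFibration_compl_of_baseChangeHom_piece σ
        g₀ (d := d) (Wc c) (hWcl c) (hWirr c) C₀ hC₀
      exact ⟨Oc, hη, Or.inr hT⟩
  choose Oc hηOc hOc using hpiece
  let O : B₀.left.Opens :=
    ⟨⋂ c, (Oc c : Set B₀.left), isOpen_iInter_of_finite fun c => (Oc c).isOpen⟩
  have hOle : ∀ c, (O : Set B₀.left) ⊆ Oc c := fun c => Set.iInter_subset _ c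
  refine ⟨O, Set.mem_iInter.2 hηOc, ?_⟩
  -- ### glue over the partition by components
  let Tot := {x : ComplexPoints X // prX x.pt ∉ C₀ ∧ prB (g.left x.pt) ∈ O}
  let proj : Tot → {β : ComplexPoints B // prB β.pt ∈ O} := fun x => ⟨AlgPoints.map g x.1, x.2.2⟩
  change IsLocallyTrivialFibration proj
  refine IsLocallyTrivialFibration.of_isLocallyConstant (fun x : Tot => part x.1)
    (hpart.comp_continuous continuous_subtype_val) fun c => ?_
  rcases hOc c with hcC | hT
  · -- a component inside `C₀`: empty piece
    haveI : IsEmpty {x : Tot // part x.1 = c} := ⟨fun x => x.1.2.1 (by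
      have h := hmem_part x.1.1
      rw [x.2, ← SetLike.mem_coe, hWc] at h
      exact hcC h)⟩
    exact IsLocallyTrivialFibration.of_isEmpty _
  · -- a component not inside `C₀`: restrict the triviality over `Oc c` to `O` and transport
    let O' : Set {β : ComplexPoints B // prB β.pt ∈ Oc c} := {β | prB β.1.pt ∈ O}
    have hO' : IsOpen O' :=
      (AlgPoints.isOpen_setOf_pt_mem (prB ⁻¹ᵁ O)).preimage continuous_subtype_val
    have hT' := hT.restrict_preimage hO'
    -- the homeomorphisms of total spaces and bases
    obtain ⟨α, hα⟩ := exists_homeomorph_of_range_eq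
      (i := fun x : {x : Tot // part x.1 = c} => (x.1.1 : ComplexPoints X))
      (j := fun y : ↥((fun x : {x : ComplexPoints X // prX x.pt ∈ Wc c ∧ prX x.pt ∉ C₀ ∧
          prB (g.left x.pt) ∈ Oc c} => (⟨AlgPoints.map g x.1, x.2.2.2⟩ :
            {β : ComplexPoints B // prB β.pt ∈ Oc c})) ⁻¹' O') =>
        (y.1.1 : ComplexPoints X))
      (IsEmbedding.subtypeVal.comp IsEmbedding.subtypeVal)
      (IsEmbedding.subtypeVal.comp IsEmbedding.subtypeVal) (by
        ext z
        constructor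
        · rintro ⟨x, rfl⟩
          exact ⟨⟨⟨x.1.1, (congrArg (fun c' => prX x.1.1.pt ∈ Wc c') x.2).mp (hmem_part x.1.1),
            x.1.2.1, hOle c x.1.2.2⟩, x.1.2.2⟩, rfl⟩
        · rintro ⟨y, rfl⟩
          exact ⟨⟨⟨y.1.1, y.1.2.2.1, y.2⟩, hpart_eq _ c y.1.2.1⟩, rfl⟩)
    obtain ⟨β, hβ⟩ := exists_homeomorph_of_range_eq
      (i := fun b : {β : ComplexPoints B // prB β.pt ∈ O} => (b.1 : ComplexPoints B))
      (j := fun b : ↥O' => (b.1.1 : ComplexPoints B))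
      IsEmbedding.subtypeVal (IsEmbedding.subtypeVal.comp IsEmbedding.subtypeVal) (by
        ext z
        constructor
        · rintro ⟨b, rfl⟩
          exact ⟨⟨⟨b.1, hOle c b.2⟩, b.2⟩, rfl⟩
        · rintro ⟨b', rfl⟩
          exact ⟨⟨b'.1.1, b'.2⟩, rfl⟩)
    refine IsLocallyTrivialFibration.of_homeomorph hT' α β fun x => ?_
    apply Subtype.ext
    apply Subtype.ext
    change AlgPoints.map g ((α x).1.1 : ComplexPoints X) = ((β (proj x.1)).1.1 : ComplexPoints B)
    rw [hβ, hα]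

end Pieces

end Literature.AlgebraicGeometry.HodgeTheory

end
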